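import Summits.QuantumFields.YangMills.Theorems.LangevinControlUVOSLegsFromFemtoAndGapStubAssemblyNontrivial
import HarnessLib

/-!
# Crux `NT` (stmt-QuantumFields-19353): toolkit XI-b in SEQUENCE form — non-triviality / non-Gaussianity of the limit
# from floors that hold EVENTUALLY ALONG THE SCHEME

Helper file (`--supports stmt-QuantumFields-19353`) of the fleet lead prover of crux `NT` (unit `ym-spine-19353-p1`, g29),
hypothesis-free.  The tree's toolkit XI-b (`OSLegsFromFemtoAndGap.twoPointNontrivial_of_lowerBounds` /
`nonGaussian_of_lowerBounds`, file `Theorems/LangevinControlUVOSLegsFromFemtoAndGapStubAssemblyNontrivial.lean`) takes the k-free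
lattice lower bounds `LowerBounds` (i) / (ii) — floors at EVERY coupling `β ≥ β₅` on EVERY torus `2L+1` with `Λ₅ ≤ a(β) L` — and
uses them at exactly one place: `∀ᶠ k, ε ≤ Q2 (β_k) (L_k) (a β_k) (θv) v` (resp. `ε ≤ |Q3 … f g h|`) along the scheme
`(β_k, L_k)` the soft bundle is extracted on.  This file records the two lemmas with THAT as the hypothesis:

* `twoPointNontrivial_of_eventually_q2Floor` — if `ε ≤ Q2 G r (β_k) (L_k) (a β_k) (θv) v` for all large `k` (`v` real,
  supported in positive time, `ε > 0`), the centred lattice two-point distributions converge on `⁰𝒮` to `S₁ 2` and `S₁ 1 = 0`,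
  then the spine-shape non-triviality clause holds for `S₁.toLabelled`;
* `nonGaussian_of_eventually_q3Floor` — likewise the non-Gaussianity clause from `ε ≤ |Q3 G r (β_k) (L_k) (a β_k) f g h|` for all
  large `k` (`f, g, h` real with pairwise disjoint supports);
* the tree's XI-b lemmas are the special case «floor at every `β ≥ β₅`, every torus with `Λ₅ ≤ a β L`, scheme with `β_k → ∞`,
  `a(β_k) L_k → ∞`» (two `Filter.eventually_ge_atTop` lines; not restated here).

WHY.  Used by `Theorems/BalabanLadderNTSubsequentialGrowth.lean` (the soft bundle with the tori CHOSEN where NT's floors hold) and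
`…NTSubsequentialBridge.lean` (`YangMills` from `UV ∧ ROT ∧` IR and NT on a cofinal set of couplings, NT's floors on tori of
unbounded size only): the summit bridge consumes `NT` only in this sequence form.  HONEST FRAMING: soft bookkeeping over tree
theorems; the floors are HYPOTHESES; nothing here proves `NT`, a floor, the gap, or Clay.

References: K. Osterwalder, R. Schrader, CMP 31 (1973) §2 (`⁰𝒮`); K. Osterwalder, E. Seiler, Ann. Phys. 110 (1978) §2;
A. Jaffe, E. Witten (2006) §5–§6 (non-triviality as a property of the limit); the tree files above. [folklore]
-/

set_option autoImplicit false

noncomputable section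

open scoped SchwartzMap BigOperators
open MeasureTheory Filter Topology
open Literature.MathematicalPhysics.QuantumFieldTheory Literature.MathematicalPhysics.QuantumLattice
open Literature.MathematicalPhysics.AQFT
open Literature.Probability.LatticeModels (box Site)
open Summit.QuantumFields.YangMills.Cruxes.OSLegsFromFemtoAndGap.DlrCollarTransfer (Q2 Q3 LowerBounds)
open Summit.QuantumFields.YangMills.Theorems.HypercubicLimit.Negative
  (tensor₁ tensor₂ thetaTensor₁ tensor₂_apply isTensorOf_tensor₂ twoPointNontrivial_of_real
    isOffDiagonal_of_halfSpaces tsupport_thetaTest_neg)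

namespace Summit.QuantumFields.YangMills.Theorems.OSLegsFromFemtoAndGap

variable {G : Type} [Group G] [TopologicalSpace G] [IsTopologicalGroup G] [CompactSpace G]
  [MeasurableSpace G] [BorelSpace G]

/-! ## §1 Non-triviality from a two-point floor holding eventually along the scheme -/

/-- **Non-triviality of the limit from a two-point floor EVENTUALLY ALONG THE SCHEME.**  Couplings `β_k`, tori `2L_k+1`
(no growth condition is needed here), a real Schwartz `v` supported in positive time and `ε > 0` with
`ε ≤ Q2 G r β_k L_k (a β_k) (θv) v` for all large `k`; if the centred lattice two-point distributions converge on `⁰𝒮` to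
`S₁ 2` and `S₁ 1 = 0`, the spine-shape non-triviality clause holds for `S₁.toLabelled` (tree certificate
`HypercubicLimit.Negative.twoPointNontrivial_of_real` with `u = θv`). [folklore] -/
theorem twoPointNontrivial_of_eventually_q2Floor (r : LatticeRep G) {a : ℝ → ℝ} {v : 𝓢(EuclideanSpace ℝ (Fin 4), ℝ)}
    (hv : tsupport (v : EuclideanSpace ℝ (Fin 4) → ℝ) ⊆ {y : EuclideanSpace ℝ (Fin 4) | 0 < y 0}) {ε : ℝ} (hε : 0 < ε) (βs : ℕ → ℝ) (Ls : ℕ → ℕ)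
    (hev : ∀ᶠ k in atTop, ε ≤ Q2 G r (βs k) (Ls k) (a (βs k)) (thetaTest 4 v) v)
    (S₁ : SchwingerFamily (EuclideanSpace ℝ (Fin 4))) (h1 : ∀ F : 𝓢((Fin 1 → EuclideanSpace ℝ (Fin 4)), ℂ), S₁ 1 F = 0)
    (hconv : ∀ F : 𝓢((Fin 2 → EuclideanSpace ℝ (Fin 4)), ℂ), IsOffDiagonal F →
      Tendsto (fun k => latticeDist r.ρ (βs k) (Ls k) (a (βs k)) r.curvature.F
        (wilsonTorusMean r.ρ (βs k) (Ls k) r.curvature.F) 2 F) atTop (𝓝 (S₁ 2 F))) :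
    ∃ (F₁ G₁ : 𝓢((Fin 1 → EuclideanSpace ℝ (Fin 4)), ℂ)) (H₁ : 𝓢((Fin (1 + 1) → EuclideanSpace ℝ (Fin 4)), ℂ)),
      IsTimeOrdered F₁ ∧ IsTimeOrdered G₁ ∧ IsAppendTensorOf H₁ (osAdjoint F₁) G₁ ∧
        S₁.toLabelled (1 + 1) (fun _ => ()) H₁ ≠
          S₁.toLabelled 1 (fun _ => ()) (osAdjoint F₁) * S₁.toLabelled 1 (fun _ => ()) G₁ := by
  have hu := tsupport_thetaTest_neg hv
  refine twoPointNontrivial_of_real S₁.toLabelled () hu hv ?_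
  simp only [SchwingerFamily.toLabelled_apply, h1, mul_zero]
  -- the two-point value is the limit of `Q2(θv, v) ≥ ε`
  have hT : IsOffDiagonal (tensor₂ (thetaTest 4 v) v) := isOffDiagonal_of_halfSpaces hu hv (isTensorOf_tensor₂ _ _)
  have hlim := hconv (tensor₂ (thetaTest 4 v) v) hT
  have hQ2 : ∀ k, latticeDist r.ρ (βs k) (Ls k) (a (βs k)) r.curvature.F
      (wilsonTorusMean r.ρ (βs k) (Ls k) r.curvature.F) 2 (tensor₂ (thetaTest 4 v) v) =
        (Q2 G r (βs k) (Ls k) (a (βs k)) (thetaTest 4 v) v : ℂ) := fun k =>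
    latticeDist_two_tensor r _ _ _ (thetaTest 4 v) v _ (isTensorOf_tensor₂ _ _)
  have hre : Tendsto (fun k => (latticeDist r.ρ (βs k) (Ls k) (a (βs k)) r.curvature.F
      (wilsonTorusMean r.ρ (βs k) (Ls k) r.curvature.F) 2 (tensor₂ (thetaTest 4 v) v)).re) atTop
      (𝓝 (S₁ 2 (tensor₂ (thetaTest 4 v) v)).re) := (Complex.continuous_re.tendsto _).comp hlim
  have hge : ε ≤ (S₁ 2 (tensor₂ (thetaTest 4 v) v)).re :=
    ge_of_tendsto hre (hev.mono fun k hk => by rw [hQ2 k, Complex.ofReal_re]; exact hk)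
  intro h0
  have : (S₁ 2 (tensor₂ (thetaTest 4 v) v)).re = 0 := by
    rw [show S₁ 2 (tensor₂ (thetaTest 4 v) v) = 0 from h0, Complex.zero_re]
  linarith

/-! ## §2 Non-Gaussianity from a three-point floor holding eventually along the scheme -/

/-- **Non-Gaussianity of the limit from a three-point floor EVENTUALLY ALONG THE SCHEME.**  Real Schwartz `f, g, h` with
pairwise disjoint supports, `ε > 0` with `ε ≤ |Q3 G r β_k L_k (a β_k) f g h|` for all large `k`; if the centred lattice
three-point distributions converge on `⁰𝒮` to `S₁ 3` and `S₁ 1 = 0`, the spine-shape non-Gaussianity clause holds for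
`S₁.toLabelled` (the cumulant combination is `S₁ 3 (f ⊗ g ⊗ h)`, and `f ⊗ g ⊗ h ∈ ⁰𝒮`). [folklore] -/
theorem nonGaussian_of_eventually_q3Floor (r : LatticeRep G) {a : ℝ → ℝ} {f g h : 𝓢(EuclideanSpace ℝ (Fin 4), ℝ)}
    (hfg : Disjoint (tsupport f) (tsupport g)) (hgh : Disjoint (tsupport g) (tsupport h))
    (hfh : Disjoint (tsupport f) (tsupport h)) {ε : ℝ} (hε : 0 < ε) (βs : ℕ → ℝ) (Ls : ℕ → ℕ)
    (hev : ∀ᶠ k in atTop, ε ≤ |Q3 G r (βs k) (Ls k) (a (βs k)) f g h|)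
    (S₁ : SchwingerFamily (EuclideanSpace ℝ (Fin 4))) (h1 : ∀ F : 𝓢((Fin 1 → EuclideanSpace ℝ (Fin 4)), ℂ), S₁ 1 F = 0)
    (hconv : ∀ F : 𝓢((Fin 3 → EuclideanSpace ℝ (Fin 4)), ℂ), IsOffDiagonal F →
      Tendsto (fun k => latticeDist r.ρ (βs k) (Ls k) (a (βs k)) r.curvature.F
        (wilsonTorusMean r.ρ (βs k) (Ls k) r.curvature.F) 3 F) atTop (𝓝 (S₁ 3 F))) :
    ∃ (f g h : 𝓢(EuclideanSpace ℝ (Fin 4), ℂ)) (Ffgh : 𝓢((Fin 3 → EuclideanSpace ℝ (Fin 4)), ℂ)) (Fgh Ffh Ffg : 𝓢((Fin 2 → EuclideanSpace ℝ (Fin 4)), ℂ))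
      (Ff Fg Fh : 𝓢((Fin 1 → EuclideanSpace ℝ (Fin 4)), ℂ)),
      IsTensorOf Ffgh ![f, g, h] ∧ IsOffDiagonal Ffgh ∧ IsTensorOf Fgh ![g, h] ∧
      IsTensorOf Ffh ![f, h] ∧ IsTensorOf Ffg ![f, g] ∧ IsTensorOf Ff ![f] ∧ IsTensorOf Fg ![g] ∧
      IsTensorOf Fh ![h] ∧
        S₁.toLabelled 3 (fun _ => ()) Ffgh - S₁.toLabelled 1 (fun _ => ()) Ff * S₁.toLabelled 2 (fun _ => ()) Fgh -
          S₁.toLabelled 1 (fun _ => ()) Fg * S₁.toLabelled 2 (fun _ => ()) Ffh -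
          S₁.toLabelled 1 (fun _ => ()) Fh * S₁.toLabelled 2 (fun _ => ()) Ffg +
          2 * (S₁.toLabelled 1 (fun _ => ()) Ff * S₁.toLabelled 1 (fun _ => ()) Fg *
            S₁.toLabelled 1 (fun _ => ()) Fh) ≠ 0 := by
  set T3 : 𝓢((Fin 3 → EuclideanSpace ℝ (Fin 4)), ℂ) := SchwartzMap.tensorFin 3 ![ofRealTest f, ofRealTest g, ofRealTest h]
  have hT3 : IsTensorOf T3 ![ofRealTest f, ofRealTest g, ofRealTest h] := isTensorOf_tensorFin _
  have hT3' : IsTensorOf T3 (fun i => ofRealTest (![f, g, h] i)) := by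
    intro x; rw [hT3 x]
    congr 1; funext i; fin_cases i <;> rfl
  have hod : IsOffDiagonal T3 := isOffDiagonal_of_disjoint_three hfg hgh hfh hT3
  refine ⟨ofRealTest f, ofRealTest g, ofRealTest h, T3,
    SchwartzMap.tensorFin 2 ![ofRealTest g, ofRealTest h], SchwartzMap.tensorFin 2 ![ofRealTest f, ofRealTest h],
    SchwartzMap.tensorFin 2 ![ofRealTest f, ofRealTest g], SchwartzMap.tensorFin 1 ![ofRealTest f],
    SchwartzMap.tensorFin 1 ![ofRealTest g], SchwartzMap.tensorFin 1 ![ofRealTest h], hT3, hod,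
    isTensorOf_tensorFin _, isTensorOf_tensorFin _, isTensorOf_tensorFin _, isTensorOf_tensorFin _,
    isTensorOf_tensorFin _, isTensorOf_tensorFin _, ?_⟩
  simp only [SchwingerFamily.toLabelled_apply, h1, zero_mul, sub_zero, mul_zero, add_zero]
  -- `S₁ 3 (f ⊗ g ⊗ h)` is the limit of `Q3(f, g, h)`, `|Q3| ≥ ε` eventually
  have hlim := hconv T3 hod
  have hQ3 : ∀ k, latticeDist r.ρ (βs k) (Ls k) (a (βs k)) r.curvature.F
      (wilsonTorusMean r.ρ (βs k) (Ls k) r.curvature.F) 3 T3 = (Q3 G r (βs k) (Ls k) (a (βs k)) f g h : ℂ) :=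
    fun k => latticeDist_three_tensor r _ _ _ f g h _ hT3'
  have hnorm : Tendsto (fun k => ‖latticeDist r.ρ (βs k) (Ls k) (a (βs k)) r.curvature.F
      (wilsonTorusMean r.ρ (βs k) (Ls k) r.curvature.F) 3 T3‖) atTop (𝓝 ‖S₁ 3 T3‖) :=
    (continuous_norm.tendsto _).comp hlim
  have hge : ε ≤ ‖S₁ 3 T3‖ :=
    ge_of_tendsto hnorm (hev.mono fun k hk => by rw [hQ3 k, Complex.norm_real, Real.norm_eq_abs]; exact hk)
  intro h0
  rw [h0, norm_zero] at hge
  linarith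

end Summit.QuantumFields.YangMills.Theorems.OSLegsFromFemtoAndGap

end
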